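import Summits.HodgeConjecture.CorCM.Census.CentralSquaresPartnersPair

/-!
# The square-central class, LIV: the pair relation `R(T) + Y'_a + Y'_{σa}` at a dihedral-type partner of a MULTI-PARTNER base block

COR-CM (cell `pub-hodgecm2`), count-neutral kernel combinatorics by the binder seat b09 (gen 50; lane SQUARE-CENTRAL CLASS, part LIV), on part LIII
(`Census/CentralSquaresPartnersPair.lean`: `single_sub_thetaG_mem_transversal_pair_partners`, the level-`m + 2` star normal form toward `T₀` in a
multi-partner block), part LI (`hbase_exchange_partners`, `card_sdiff_exchange_partners`), parts V–VI (`cover_frame`, `swap_preserves_frame`,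
`transversal_frame`, `sdiff_eq_of_dev`, `exists_type_of_dev`, `thetaG_frame`, `card_frame`), all BY NAME.  Theorems only: no definition, no `decide`, no
certificate, no named fact, no `sorry`.  HONEST FRAMING: `HC_CM` is NOT proved, here or anywhere in the tree; nothing here is a period or a headline.

THE SETTING of parts LI–LIII: a multi-partner base block, a dihedral-type partner `T₁` with swap `Q`, a strict lowering cover in a base-change stable
lattice `L`, a transversal `T ⊆ 𝓗` of size `m ≥ 3`, `a ∈ T₀ ∩ T₁` with `a' = σa ≠ a`, and the other partners far from the two level-`(m+2)` classes
(`hfar₀`, `hfar₁`; in the affine rank-two blocks: `3 ≤ |T ∩ 𝓗'| ≤ m − 3`, i.e. `m ≥ 8`).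

* §2 `single_sub_thetaG_mem_transversal_pair_partners_exchange`: part LIII in the exchanged multi-partner frame `(T₁; T₀, Q)` (partners
  `insert T₀ (𝒯.erase T₁)`): star normal form toward `T₁` of the exchanged class.
* §3 **THE PAIR RELATION** (`rel_transversal_pair_mem_partners`): `R(T) + ((f_a − e₀) − (g_a − e₁)) + ((f_{a'} − e₀) − (g_{a'} − e₁)) ∈ L` — the
  difference of the two star normal forms of the type with deviation set `T ∪ {a, a'}`; with part LIʼs `R(T) ∈ L` this is `Y'_a + Y'_{a'} ∈ L`, and with
  part LIIʼs `Y'_a − Y'_{a'} ∈ L` it gives `2Y'_a ∈ L` — the relation families part XLIXʼs multi-partner closure consumes.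

## References
* [Pohlmann1968] H. Pohlmann, Algebraic cycles on abelian varieties of complex multiplication type, Ann. of Math. 88 (1968), Thm 1.
-/

namespace Summit.HodgeConjecture.CorCM.Census.CentralSquares

open Finset
open scoped symmDiff
open Summit.HodgeConjecture.CorCM.Prior.AllgGroup.RfwfAllgGroup
open Summit.HodgeConjecture.CorCM.Census.BlockParity
open Summit.HodgeConjecture.CorCM.Census.Coinvariant
open Summit.HodgeConjecture.CorCM.Census.TwistGeneration
open Summit.HodgeConjecture.CorCM.Census.BaseBlock
open Summit.HodgeConjecture.CorCM.Census.CoverClosure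

noncomputable section

variable {G : Type*} [Group G] [Fintype G] [DecidableEq G] (c : G)

section Frame

variable (hc2 : c * c = 1) (hcen : ∀ x : G, x * c = c * x) (T₀ : CMF G c) (𝒯 : Finset (CMF G c))
variable (hbase : ∀ Q : G, rt c Q T₀ = T₀ ∨ rt c Q T₀ = rt c c T₀ ∨ ∃ T₁ ∈ 𝒯, rt c Q T₀ = T₁ ∨ rt c Q T₀ = rt c c T₁)
variable (m : ℕ) (hn : T₀.1.card = 4 * m) (hH : ∀ T₁ ∈ 𝒯, (T₀.1 \ T₁.1).card = 2 * m)
variable (hpair : ∀ T₁ ∈ 𝒯, ∀ T₂ ∈ 𝒯, T₁ ≠ T₂ → ((T₀.1 \ T₁.1) ∆ (T₀.1 \ T₂.1)).card = 2 * m)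
variable (T₁ : CMF G c) (hT₁ : T₁ ∈ 𝒯) (Q : G) (hQ : rt c Q T₀ = T₁) (hQQ : Q * Q = 1)
variable (L : Submodule ℤ (CMF G c →₀ ℤ)) (hLrt : ∀ (Q' : G) (y : CMF G c →₀ ℤ), y ∈ L → Finsupp.mapDomain (rt c Q') y ∈ L)
variable (hcover : ∀ Ψ : CMF G c, 2 ≤ bpot c T₀ Ψ → ∃ Q₂ s s' : G, bpot c T₀ Ψ = ddist (rt c Q₂ T₀) Ψ ∧
    s ∈ (rt c Q₂ T₀).1 \ Ψ.1 ∧ s' ∈ (rt c Q₂ T₀).1 \ Ψ.1 ∧ s ≠ s' ∧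
    gface c hc2 Ψ s s' ∈ L ∧
    ((∃ Q₁ t t' : G, bpot c T₀ Ψ = ddist (rt c Q₁ T₀) Ψ ∧ t ∈ (rt c Q₁ T₀).1 \ Ψ.1 ∧ t' ∈ (rt c Q₁ T₀).1 \ Ψ.1 ∧ t ≠ t' ∧
        (∀ Q' : G, ddist (rt c Q' T₀) (oflipCM c hc2 t Ψ) = bpot c T₀ (oflipCM c hc2 t Ψ) → rt c Q' T₀ = rt c Q₁ T₀) ∧
        (∀ Q' : G, ddist (rt c Q' T₀) (oflipCM c hc2 t' Ψ) = bpot c T₀ (oflipCM c hc2 t' Ψ) → rt c Q' T₀ = rt c Q₁ T₀) ∧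
        (∀ Q' : G, ddist (rt c Q' T₀) (oflipCM c hc2 t (oflipCM c hc2 t' Ψ)) = bpot c T₀ (oflipCM c hc2 t (oflipCM c hc2 t' Ψ)) →
          rt c Q' T₀ = rt c Q₁ T₀)) →
      (∀ Q' : G, ddist (rt c Q' T₀) (oflipCM c hc2 s Ψ) = bpot c T₀ (oflipCM c hc2 s Ψ) → rt c Q' T₀ = rt c Q₂ T₀) ∧
      (∀ Q' : G, ddist (rt c Q' T₀) (oflipCM c hc2 s' Ψ) = bpot c T₀ (oflipCM c hc2 s' Ψ) → rt c Q' T₀ = rt c Q₂ T₀) ∧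
      (∀ Q' : G, ddist (rt c Q' T₀) (oflipCM c hc2 s (oflipCM c hc2 s' Ψ)) = bpot c T₀ (oflipCM c hc2 s (oflipCM c hc2 s' Ψ)) →
        rt c Q' T₀ = rt c Q₂ T₀)))

/-! ## §2 Level `m + 2` toward `T₁` (exchanged multi-partner frame) -/

include hcen hbase hn hH hpair hT₁ hQ hQQ hLrt hcover in
/-- **STAR NORMAL FORM TOWARD `T₁` AT LEVEL `m + 2` (multi-partner block)**: §1 in the exchanged frame `(T₁; T₀, Q)` with partners
`insert T₀ (𝒯.erase T₁)` and the other partners far from the exchanged class (`hfar₁`). [folklore] -/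
theorem single_sub_thetaG_mem_transversal_pair_partners_exchange (hm : 3 ≤ m)
    (hσH : ∀ t ∈ T₀.1, ∀ t' ∈ T₀.1, (t' = t * Q ∨ t' = c * (t * Q)) → (t ∈ T₀.1 \ T₁.1 ↔ t' ∈ T₀.1 \ T₁.1))
    (T : Finset G) (hTH : T ⊆ T₀.1 \ T₁.1) (hTm : T.card = m)
    (hT : ∀ t ∈ T₀.1 \ T₁.1, ∀ t' ∈ T₀.1, (t' = t * Q ∨ t' = c * (t * Q)) → (t ∈ T ↔ t' ∉ T))
    {a a' : G} (ha : a ∈ T₀.1) (ha1 : a ∈ T₁.1) (ha' : a' ∈ T₀.1) (haa' : a' = a * Q ∨ a' = c * (a * Q)) (hne : a ≠ a')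
    (hfar₁ : ∀ T₂ ∈ 𝒯, T₂ ≠ T₁ → ∀ X : CMF G c, T₁.1 \ X.1 ⊆ ((T₀.1 \ T₁.1) \ T).image (fun x => c * x) ∪ {a, a'} →
      (T₁.1 \ X.1).card < ddist T₂ X ∧ (T₁.1 \ X.1).card < ddist (rt c c T₂) X) :
    ∀ X : CMF G c, (T₁.1 \ X.1 ⊆ ((T₀.1 \ T₁.1) \ T).image (fun x => c * x) ∪ {a, a'} ∧
        (T₁.1 \ X.1 = ((T₀.1 \ T₁.1) \ T).image (fun x => c * x) ∪ {a, a'} ∨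
          ¬ ((T₀.1 \ T₁.1) \ T).image (fun x => c * x) ⊆ T₁.1 \ X.1)) →
      Finsupp.single X 1 - thetaG c hc2 T₁ (typeSum G c (Finsupp.single X 1)) ∈ L := by
  classical
  have hQ₁ : rt c Q T₁ = T₀ := by rw [← hQ, ← rt_mul, hQQ, rt_one]
  have hcov := cover_frame c hc2 T₀ L Q hcover
  simp only [hQ] at hcov
  have hH₁ := card_sdiff_exchange_partners c hc2 T₀ 𝒯 m hH hpair hT₁
  have hsub : ((T₀.1 \ T₁.1) \ T).image (fun x => c * x) ⊆ T₁.1 \ T₀.1 := by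
    intro x hx
    obtain ⟨u, hu, rfl⟩ := mem_image.mp hx
    obtain ⟨hu0, hu1⟩ := mem_sdiff.mp (mem_sdiff.mp hu).1
    exact mem_sdiff.mpr ⟨by by_contra h; exact hu1 ((T₁.2 u).mpr h), (T₀.2 u).mp hu0⟩
  have hcard : (((T₀.1 \ T₁.1) \ T).image (fun x => c * x)).card = m := by
    rw [card_image_of_injective _ (mul_right_injective c), card_sdiff_of_subset hTH, hH T₁ hT₁, hTm]; omega
  have ha'1 : a' ∈ T₁.1 := by
    have h := (hσH a ha a' ha' haa')
    by_contra h'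
    exact (mem_sdiff.mp (h.mpr (mem_sdiff.mpr ⟨ha', h'⟩))).2 ha1
  have haH₁ : a ∉ T₁.1 \ T₀.1 := fun h => (mem_sdiff.mp h).2 ha
  have hT₀ne : ∀ T₂ ∈ 𝒯, T₂ ≠ T₀ := by
    intro T₂ hT₂ h; have h' := hH T₂ hT₂; rw [h, Finset.sdiff_self, Finset.card_empty] at h'; omega
  have hfar' : ∀ T₂ ∈ insert T₀ (𝒯.erase T₁), T₂ ≠ T₀ → ∀ X : CMF G c,
      T₁.1 \ X.1 ⊆ ((T₀.1 \ T₁.1) \ T).image (fun x => c * x) ∪ {a, a'} →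
      (T₁.1 \ X.1).card < ddist T₂ X ∧ (T₁.1 \ X.1).card < ddist (rt c c T₂) X := by
    intro T₂ hT₂ hne₀ X hX
    rcases mem_insert.mp hT₂ with h | h
    · exact absurd h hne₀
    · obtain ⟨h21, h2𝒯⟩ := mem_erase.mp h
      exact hfar₁ T₂ h2𝒯 h21 X hX
  exact single_sub_thetaG_mem_transversal_pair_partners c hc2 hcen T₁ (insert T₀ (𝒯.erase T₁)) (hbase_exchange_partners c hbase hQ) m
    (card_frame c hc2 T₀ T₁ m hn) hH₁ T₀ (mem_insert_self _ _) Q hQ₁ hQQ L hLrt hcov hm (swap_preserves_frame c hc2 T₀ T₁ Q hσH) _ hsub hcard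
    (transversal_frame c hc2 T₀ T₁ Q hσH T hT) ha1 haH₁ ha'1 haa' hne hfar'

/-! ## §3 The pair relation -/

include hcen hbase hn hH hpair hT₁ hQ hQQ hLrt hcover in
/-- **THE PAIR RELATION `R(T) + Y'_a + Y'_{a'} ∈ L` IN A MULTI-PARTNER BLOCK** (`m ≥ 3`): for a transversal `T ⊆ 𝓗` with `|T| = m`, `a ∈ T₀ ∩ T₁` and its
swap image `a' ≠ a`, the other partners far from both classes: `R(T) + ((f_a − e₀) − (g_a − e₁)) + ((f_{a'} − e₀) − (g_{a'} − e₁)) ∈ L`. [folklore] -/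
theorem rel_transversal_pair_mem_partners (hm : 3 ≤ m)
    (hσH : ∀ t ∈ T₀.1, ∀ t' ∈ T₀.1, (t' = t * Q ∨ t' = c * (t * Q)) → (t ∈ T₀.1 \ T₁.1 ↔ t' ∈ T₀.1 \ T₁.1))
    (T : Finset G) (hTH : T ⊆ T₀.1 \ T₁.1) (hTm : T.card = m)
    (hT : ∀ t ∈ T₀.1 \ T₁.1, ∀ t' ∈ T₀.1, (t' = t * Q ∨ t' = c * (t * Q)) → (t ∈ T ↔ t' ∉ T))
    {a a' : G} (ha : a ∈ T₀.1) (ha1 : a ∈ T₁.1) (ha' : a' ∈ T₀.1) (haa' : a' = a * Q ∨ a' = c * (a * Q)) (hne : a ≠ a')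
    (hfar₀ : ∀ T₂ ∈ 𝒯, T₂ ≠ T₁ → ∀ X : CMF G c, T₀.1 \ X.1 ⊆ T ∪ {a, a'} →
      (T₀.1 \ X.1).card < ddist T₂ X ∧ (T₀.1 \ X.1).card < ddist (rt c c T₂) X)
    (hfar₁ : ∀ T₂ ∈ 𝒯, T₂ ≠ T₁ → ∀ X : CMF G c, T₁.1 \ X.1 ⊆ ((T₀.1 \ T₁.1) \ T).image (fun x => c * x) ∪ {a, a'} →
      (T₁.1 \ X.1).card < ddist T₂ X ∧ (T₁.1 \ X.1).card < ddist (rt c c T₂) X) :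
    (∑ s ∈ T, Finsupp.single (oflipCM c hc2 s T₀) (1 : ℤ) - ∑ u ∈ (T₀.1 \ T₁.1) \ T, Finsupp.single (oflipCM c hc2 u T₁) (1 : ℤ) -
      ((m : ℤ) - 1) • (Finsupp.single T₀ (1 : ℤ) - Finsupp.single T₁ 1)) +
      ((Finsupp.single (oflipCM c hc2 a T₀) (1 : ℤ) - Finsupp.single T₀ 1) - (Finsupp.single (oflipCM c hc2 a T₁) (1 : ℤ) - Finsupp.single T₁ 1)) +
      ((Finsupp.single (oflipCM c hc2 a' T₀) (1 : ℤ) - Finsupp.single T₀ 1) - (Finsupp.single (oflipCM c hc2 a' T₁) (1 : ℤ) - Finsupp.single T₁ 1))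
      ∈ L := by
  have ha'1 : a' ∈ T₁.1 := by
    have h := (hσH a ha a' ha' haa')
    by_contra h'
    exact (mem_sdiff.mp (h.mpr (mem_sdiff.mpr ⟨ha', h'⟩))).2 ha1
  have haH : a ∉ T₀.1 \ T₁.1 := fun h => (mem_sdiff.mp h).2 ha1
  have ha'H : a' ∉ T₀.1 \ T₁.1 := fun h => (mem_sdiff.mp h).2 ha'1
  have hTA : Disjoint T ({a, a'} : Finset G) := by
    rw [disjoint_iff_ne]; rintro x hx y hy rfl
    rw [mem_insert, mem_singleton] at hy
    rcases hy with rfl | rfl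
    · exact haH (hTH hx)
    · exact ha'H (hTH hx)
  have hAsub : ({a, a'} : Finset G) ⊆ T₀.1 := by
    intro x hx; rw [mem_insert, mem_singleton] at hx; rcases hx with rfl | rfl <;> assumption
  obtain ⟨Φ, hΦ⟩ := exists_type_of_dev c hc2 T₀ (T ∪ {a, a'}) (union_subset (hTH.trans sdiff_subset) hAsub)
  have h0 := single_sub_thetaG_mem_transversal_pair_partners c hc2 hcen T₀ 𝒯 hbase m hn hH T₁ hT₁ Q hQ hQQ L hLrt hcover hm hσH T hTH hTm hT
    ha haH ha' haa' hne hfar₀ Φ ⟨by rw [hΦ], Or.inl hΦ⟩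
  have hD1 : (T₀.1 \ Φ.1) \ (T₀.1 \ T₁.1) = {a, a'} := by
    rw [hΦ, union_sdiff_distrib, Finset.sdiff_eq_empty_iff_subset.mpr hTH, empty_union]
    ext x; simp only [mem_sdiff, mem_insert, mem_singleton]
    constructor
    · exact fun h => h.1
    · rintro (rfl | rfl)
      · exact ⟨Or.inl rfl, fun h => haH (mem_sdiff.mpr h)⟩
      · exact ⟨Or.inr rfl, fun h => ha'H (mem_sdiff.mpr h)⟩
  have hD2 : (T₀.1 \ T₁.1) \ (T₀.1 \ Φ.1) = (T₀.1 \ T₁.1) \ T := by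
    rw [hΦ]
    ext x; simp only [mem_sdiff, mem_union, mem_insert, mem_singleton, not_or]
    constructor
    · rintro ⟨h, h1, -⟩; exact ⟨h, h1⟩
    · rintro ⟨h, h1⟩
      refine ⟨h, h1, ?_, ?_⟩
      · rintro rfl; exact haH (mem_sdiff.mpr h)
      · rintro rfl; exact ha'H (mem_sdiff.mpr h)
  have hdev₁ : T₁.1 \ Φ.1 = ((T₀.1 \ T₁.1) \ T).image (fun x => c * x) ∪ {a, a'} := by
    rw [sdiff_eq_of_dev c hc2 T₀ T₁ Φ, hD1, hD2, union_comm]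
  have h1 := single_sub_thetaG_mem_transversal_pair_partners_exchange c hc2 hcen T₀ 𝒯 hbase m hn hH hpair T₁ hT₁ Q hQ hQQ L hLrt hcover hm
    hσH T hTH hTm hT ha ha1 ha' haa' hne hfar₁ Φ ⟨by rw [hdev₁], Or.inl hdev₁⟩
  have hdiff := Submodule.sub_mem _ h1 h0
  rw [sub_sub_sub_cancel_left, thetaG_typeSum_single c T₀ hc2 Φ, thetaG_frame c hc2 T₀ T₁ Φ, hD1, hD2, hΦ,
    sum_union hTA, sum_pair hne, sum_pair hne] at hdiff
  have hcardD : (((T₀.1 \ T₁.1) \ T).card : ℤ) = m := by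
    have h : ((T₀.1 \ T₁.1) \ T).card = m := by rw [card_sdiff_of_subset hTH, hH T₁ hT₁, hTm]; omega
    exact_mod_cast h
  have hTm' : (T.card : ℤ) = m := by exact_mod_cast hTm
  have e : (∑ s ∈ T, Finsupp.single (oflipCM c hc2 s T₀) (1 : ℤ) - ∑ u ∈ (T₀.1 \ T₁.1) \ T, Finsupp.single (oflipCM c hc2 u T₁) (1 : ℤ) -
      ((m : ℤ) - 1) • (Finsupp.single T₀ (1 : ℤ) - Finsupp.single T₁ 1)) +
      ((Finsupp.single (oflipCM c hc2 a T₀) (1 : ℤ) - Finsupp.single T₀ 1) - (Finsupp.single (oflipCM c hc2 a T₁) (1 : ℤ) - Finsupp.single T₁ 1)) +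
      ((Finsupp.single (oflipCM c hc2 a' T₀) (1 : ℤ) - Finsupp.single T₀ 1) - (Finsupp.single (oflipCM c hc2 a' T₁) (1 : ℤ) - Finsupp.single T₁ 1)) =
      ((∑ t ∈ T, (Finsupp.single (oflipCM c hc2 t T₀) (1 : ℤ) - Finsupp.single T₀ 1)) +
        ((Finsupp.single (oflipCM c hc2 a T₀) (1 : ℤ) - Finsupp.single T₀ 1) + (Finsupp.single (oflipCM c hc2 a' T₀) (1 : ℤ) - Finsupp.single T₀ 1)) +
        Finsupp.single T₀ 1) -
      (((Finsupp.single (oflipCM c hc2 a T₁) (1 : ℤ) - Finsupp.single T₁ 1) + (Finsupp.single (oflipCM c hc2 a' T₁) (1 : ℤ) - Finsupp.single T₁ 1)) +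
        (∑ u ∈ (T₀.1 \ T₁.1) \ T, (Finsupp.single (oflipCM c hc2 u T₁) (1 : ℤ) - Finsupp.single T₁ 1)) + Finsupp.single T₁ 1) := by
    rw [sum_sub_distrib, sum_sub_distrib, sum_const, sum_const, ← Nat.cast_smul_eq_nsmul ℤ, ← Nat.cast_smul_eq_nsmul ℤ, hcardD, hTm']
    module
  rw [e]
  exact hdiff

end Frame

end

end Summit.HodgeConjecture.CorCM.Census.CentralSquares
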